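import Summits.AtomisticToContinuum.FouriersLaw.Theses.ContactStieltjesMeasure
import Literature.MathematicalPhysics.KineticTheory.LangevinChainKernel
import Mathlib.Analysis.Calculus.IteratedDeriv.Defs
import Mathlib.MeasureTheory.Integral.IntervalIntegral.Basic

/-!
# Crux `StieltjesRepresentation` (stmt-AtomisticToContinuum-15248) — ideator 4 (g14), round 2

Card `carrier-envelope-window`: first checkable statements, typed over existing declarations.
Nothing is proved here.

The crux AS FILED is kernel-equivalent to its φ⁴ corner `stub_phi4Edge` (β = 0 < lam,
`CayleyPencil.stieltjesRepresentation_iff_phi4Edge`, p167063); the corner needs exactly one dynamical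
input, `δ`-uniform tightness of the weak steady states near `(T,T)` (census F1; typed residuals
`IdeasK4g3.EquilibriumTightness`, `IdeasK5g2.GradedLeakLaw → ResponseTightness`).  This card's engine
for the windowed energy drift is PATHWISE TIME–FREQUENCY SEPARATION: over a state-dependent window the
power a high-energy block exchanges with the thermal layer splits, by Parseval on the window, into
(slow thermal) × (carrier) — which vanishes up to the carrier's out-of-band leakage, a non-stationary
phase estimate on the BLOCK's smooth envelope (`CarrierLeakage`) — and (band noise) × (carrier), a
Gaussian first-chaos pairing over lags `≤ E^ε/Ω`; the signed term is the exact energy identity of the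
lossless linear skeleton of the layer.  Target `WindowedDrain` (C⁺), hand-over `DrainGivesMoments`.
-/

noncomputable section

open MeasureTheory Set Filter Topology
open scoped NNReal BigOperators

namespace Summit.AtomisticToContinuum.FouriersLaw.Cruxes.StieltjesRepresentation.IdeasK4g14

open Literature.MathematicalPhysics.KineticTheory.HeatConduction

/-- The φ⁴ chain on the edge of the crux's range (`β = 0`). -/
def phi4 (ω₂ lam γ : ℝ) : OscillatorChain := pinnedChain ω₂ lam 0 γ

/-- **First lemma (stub 1, M): carrier leakage / non-stationary phase (tapered window).**  A carrier
`cos θ(t)` with instantaneous frequency `θ' ≥ Ω/2` whose modulation is slow (`|θ^{(j+1)}| ≤ Ω W^j`) and a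
`C^M` envelope `s` supported in the window `[0, τ]` with `|s^{(j)}| ≤ S W^j` (taper × block envelope; the
taper contributes `W ≥ 1/τ`) has Fourier coefficient at every low frequency `|ω| ≤ Ω/4` of size
`≤ C S τ (W/Ω)^M`: `M` integrations by parts against `e^{i(θ - ω t)}` (`θ' - ω ≥ Ω/4`; no boundary terms
because `s` and its first `M-1` derivatives vanish at the ends).  With Parseval on the window this makes
(slow thermal signal) × (block carrier) pair to `‖slow‖_{L²} · ‖P_{<Ω/4} carrier‖_{L²}`, small with NO
smoothness, decorrelation or mixing asked of the thermal signal — the integrations by parts fall on the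
block's envelope, the smoothest object in the chain (`C^{2n+1}` in time at depth `n`). -/
def CarrierLeakage (M : ℕ) : Prop :=
  ∃ C : ℝ, 0 < C ∧
    ∀ (S W Ω τ ω : ℝ) (s θ : ℝ → ℝ), 0 ≤ S → 0 < W → 0 < Ω → 0 < τ → |ω| ≤ Ω / 4 →
      ContDiff ℝ M s → Function.support s ⊆ Icc (0 : ℝ) τ → ContDiff ℝ (M + 1) θ →
      (∀ j : ℕ, j ≤ M → ∀ t : ℝ, |iteratedDeriv j s t| ≤ S * W ^ j) →
      (∀ t ∈ Icc (0 : ℝ) τ, Ω / 2 ≤ deriv θ t) →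
      (∀ j : ℕ, 1 ≤ j → j ≤ M → ∀ t ∈ Icc (0 : ℝ) τ, |iteratedDeriv (j + 1) θ t| ≤ Ω * W ^ j) →
      |∫ t in (0 : ℝ)..τ, s t * Real.cos (θ t - ω * t)| ≤ C * S * τ * (W / Ω) ^ M

/-- Energy of one quartic site along a trajectory `q` (used only in `AdiabaticWorkBound`). -/
def siteEnergy (ω₂ lam : ℝ) (q : ℝ → ℝ) (t : ℝ) : ℝ :=
  (deriv q t) ^ 2 / 2 + ω₂ * (q t) ^ 2 / 2 + lam * (q t) ^ 4 / 4

/-- **Third leg (stub, L): adiabatic work bound — slow forcing cannot feed the fast action.**  Typed in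
its simplest instance: ONE quartic site `q'' = -(ω₂ q + lam q³) + f` at energy `e ∈ [e₀, e₁]` (fast
frequency `≍ e^{1/4}`), driven by a force that is WEAK (`F² ≤ e₀`) and SLOW (`|f^{(j)}| ≤ F L^j`,
`L⁴ ≤ e₀`).  The work `∫ f q'` over a window is a boundary term `O(F e₁^{1/4} + F²)` (carrier boundary
term + the reactive centre-shift energy `χ f²`, `χ ≍ e^{-1/2}`) plus a leakage
`τ · F e₁^{1/2} · ((L + F e₀^{-1/2}) e₀^{-1/4})^M` — finite-order adiabatic invariance of the action, the
slowness rate being `L` (force) plus `F e^{-1/2}` (envelope).  Pure ODE statement; `M` integrations by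
parts / one-phase averaging, no small divisors.  Multi-site blocks: the same move bounds the slow-channel
work by the capacity `O(√E)` of the block's slow variables (resonance widths) — the card's residue (iv). -/
def AdiabaticWorkBound (M : ℕ) : Prop :=
  ∀ ω₂ lam : ℝ, 0 < ω₂ → 0 < lam → ∃ C e_star : ℝ, 0 < C ∧ 0 < e_star ∧
    ∀ (F L τ e₀ e₁ : ℝ) (f q : ℝ → ℝ), 0 ≤ F → 0 < L → 0 < τ → e_star ≤ e₀ → e₀ ≤ e₁ →
      L ^ 4 ≤ e₀ → F ^ 2 ≤ e₀ →
      ContDiff ℝ M f → ContDiff ℝ 2 q →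
      (∀ j : ℕ, j ≤ M → ∀ t ∈ Icc (0 : ℝ) τ, |iteratedDeriv j f t| ≤ F * L ^ j) →
      (∀ t ∈ Icc (0 : ℝ) τ, deriv (deriv q) t = -(ω₂ * q t + lam * q t ^ 3) + f t) →
      (∀ t ∈ Icc (0 : ℝ) τ, e₀ ≤ siteEnergy ω₂ lam q t ∧ siteEnergy ω₂ lam q t ≤ e₁) →
      |∫ t in (0 : ℝ)..τ, f t * deriv q t| ≤
        C * (F * e₁ ^ (1 / 4 : ℝ) + F ^ 2) +
          C * τ * F * e₁ ^ (1 / 2 : ℝ) * ((L + F * e₀ ^ (-(1 / 2) : ℝ)) * e₀ ^ (-(1 / 4) : ℝ)) ^ M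

/-- **Target (C⁺): the windowed drain law** — a multiplicative, TIME-INTEGRATED, state-dependent-window
energy drift, uniform in the bath temperatures near `T`: from EVERY state `z` of energy `H z ≥ E₀` the
mean energy after time `K · (H z)^m` is at most `(1 - c) · H z`.  (The card's engine: dressed block
energy `h_block + E_skel` obeys the exact pathwise identity `d/dt = p_c (η^L + η^R) - γ Σ_b (ξ'_b)²`;
the emission integral is `≳ E^{1-n} · window`; the cross integral is `o(emission)` by Parseval +
`CarrierLeakage` for the slow part and a first-chaos bound over lags `≤ E^ε/Ω` for the band-noise part;
`δ` enters only through the noise amplitudes `√(2γT_b)`.)  Implies `IdeasK5g2.GradedLeakLaw` for large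
`E` (drop by `1` within `K E^{m}`), and is what Meyn–Tweedie's state-dependent drift criterion
(MT 1993 Thm 19.1.2) consumes. -/
def WindowedDrain (ω₂ lam γ T : ℝ) (N : ℕ) : Prop :=
  ∃ K m E₀ δ₀ c : ℝ, 0 < K ∧ 0 ≤ m ∧ 0 < E₀ ∧ 0 < δ₀ ∧ δ₀ < T ∧ 0 < c ∧ c < 1 ∧
    ∀ T_L T_R : ℝ, |T_L - T| ≤ δ₀ → |T_R - T| ≤ δ₀ →
      ∀ z : PhaseSpace N, E₀ ≤ (phi4 ω₂ lam γ).hamiltonian N z →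
        Integrable ((phi4 ω₂ lam γ).hamiltonian N)
            ((phi4 ω₂ lam γ).transitionKernel N T_L T_R
              (K * (phi4 ω₂ lam γ).hamiltonian N z ^ m).toNNReal z) ∧
          ∫ y, (phi4 ω₂ lam γ).hamiltonian N y
              ∂((phi4 ω₂ lam γ).transitionKernel N T_L T_R
                (K * (phi4 ω₂ lam γ).hamiltonian N z ^ m).toNNReal z) ≤
            (1 - c) * (phi4 ω₂ lam γ).hamiltonian N z

/-- **Hand-over (L, standard): windowed drain ⇒ `δ`-uniform polynomial moments of every weak steady
state near `(T,T)`** (weak steady state ⇒ invariant law of the Feller kernel — Echeverría, the soft step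
shared with cards `gibbs-weighted-hypocoercivity` (B0) / `passivity-golden-rule`; then Meyn–Tweedie's
state-dependent drift criterion with `V = H^{p+m}`, `n(z) = K H(z)^m` and the compact petite sets of the
hypoelliptic chain).  Uniform moments give `IdeasK4g3.EquilibriumTightness` (hence `stub_phi4Edge` via
`IdeasK4g3.TightnessTransfer`) and, with polynomial Harris, `IdeasK5g2.ResponseTightness`. -/
def DrainGivesMoments : Prop :=
  ∀ ω₂ lam γ T : ℝ, 0 < ω₂ → 0 < lam → 0 < γ → 0 < T → ∀ N : ℕ, 2 ≤ N →
    WindowedDrain ω₂ lam γ T N →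
      ∀ p : ℕ, ∃ C δ₁ : ℝ, 0 < δ₁ ∧ δ₁ < T ∧
        ∀ δ : ℝ, |δ| ≤ δ₁ →
          ∀ μ : Measure (PhaseSpace N),
            (phi4 ω₂ lam γ).IsSteadyState N (T + δ / 2) (T - δ / 2) μ →
              Integrable (fun z => (phi4 ω₂ lam γ).hamiltonian N z ^ p) μ ∧
                ∫ z, (phi4 ω₂ lam γ).hamiltonian N z ^ p ∂μ ≤ C

end Summit.AtomisticToContinuum.FouriersLaw.Cruxes.StieltjesRepresentation.IdeasK4g14
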